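import Summits.ABC.ABC.Theses.DefiniteXi
import Summits.ABC.ABC.Theorems.DefiniteXiPolyFreyDegreeBakerShape
import HarnessLib

/-!
# Route DefiniteXi — item `PolyFreyDegree` (stmt-ABC-2026): the item sits between abc and polynomial abc

`Summit.ABC.ABC.Theses.DefiniteXi.PolyFreyDegree` (absolute `A, C` with SOME modular
parametrisation datum of every Frey curve `E_(a,b)` at its conductor level of degree `≤ C · N^A`)
is sandwiched, in the tree, between the summit statement and its polynomial weakening:

* `PolyFreyDegree → BakerShapeBound 0 1` (polynomial abc, `log c ≤ κ log rad(abc)`) is the landed,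
  unconditional `bakerShapeBound_zero_one_of_polyFreyDegree` (file `…BakerShape.lean`, (F1));
* `ABC → BakerShapeBound 0 1` (`bakerShapeBound_zero_one_of_abc`, here: `ε := 1` in abc), hence
  `ABC → PolyFreyDegree` relative to Murty's two true-in-print inputs — a polynomial Petersson upper
  bound for newforms of elliptic curves and Frey data with polynomially bounded Manin constant —
  through the landed (F3) `polyFreyDegree_of_bakerShapeBound_of_petersson_of_manin`
  (`polyFreyDegree_of_abc_of_petersson_of_manin`); contrapositively, a refutation of the item
  would refute `ABC` modulo those inputs.

So an unconditional proof of the item proves polynomial abc (beyond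
`Literature.Barriers.ABC.BakerMethodBounds` = `BakerShapeBound (1/3) 3`, Stewart–Yu 2001), and an
unconditional refutation refutes abc given two theorems of the printed literature: the item is an
open problem, expected true (`polyFreyDegree_sandwich`).  No new mathematics; this file only makes
the status machine-legible for the planner.

References: M. R. Murty, *Bounds for congruence primes*, Proc. Sympos. Pure Math. 66.1 (1999),
Thm. 1; G. Frey, *On ternary equations of Fermat type…* (1997), Cor. 3.1; C. L. Stewart, K. Yu,
Duke Math. J. 108 (2001), Thm. 1.
-/

-- `Summit.<Summit>.<Problem>` is the mandated namespace; for the single-conjunct summit ABC the duplicate ABC.ABC is deliberate.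
set_option linter.dupNamespace false

noncomputable section

namespace Summit.ABC.ABC.Theorems.DefiniteXiPolyFreyDegree

open CongruenceSubgroup
open Literature.NumberTheory.EllipticCurves
open Literature.NumberTheory.EllipticCurves.ModularForms
open Literature.NumberTheory.DiophantineGeometry
open Literature.Barriers.ABC
open Summit.ABC.ABC.Theses.DefiniteXi

/-- **abc ⟹ polynomial abc in Baker shape `(0, 1)`**: the summit statement at `ε := 1` gives
`c < C · rad(abc)²`, a polynomial abc inequality, hence `BakerShapeBound 0 1` by the landed
`bakerShapeBound_zero_one_of_polyAbc`. [folklore] -/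
theorem bakerShapeBound_zero_one_of_abc (h : _root_.ABC) : BakerShapeBound 0 1 := by
  obtain ⟨C, -, hC⟩ := h 1 one_pos
  exact bakerShapeBound_zero_one_of_polyAbc ⟨1 + 1, C, fun a b c ht ↦ (hC a b c ht).le⟩

/-- **abc ⟹ the weak rung, relative to Murty's two inputs.** Given a polynomial Petersson upper
bound `(f,f) ≤ C₂ N^B` for newforms of elliptic curves over `ℚ` and, for every Frey curve, SOME
parametrisation datum at its conductor level with polynomially bounded Manin constant (both true
in print: Rankin–Selberg; BCDT 2001 + Pasten 2024 Thm. 1.3), `ABC → PolyFreyDegree`: abc gives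
`BakerShapeBound 0 1` and (F3) `polyFreyDegree_of_bakerShapeBound_of_petersson_of_manin` applies.
[cite: MurtyCongruencePrimes1999, Thm. 1 (ii)] -/
theorem polyFreyDegree_of_abc_of_petersson_of_manin
    (hUp : ∃ B C₂ : ℝ, ∀ (N : ℕ) [NeZero N] (W : WeierstrassCurve ℚ) [W.IsElliptic]
      (f : CuspForm (Gamma0 N) 2), IsNewformOf W f →
        (peterssonProduct (Gamma0 N) 2 f f).re ≤ C₂ * (N : ℝ) ^ B)
    (hM : ∃ B' M : ℝ, ∀ a b : ℤ, IsCoprime a b → a * b * (a + b) ≠ 0 →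
      ∀ (N : ℕ) [NeZero N], (freyCurve a b).conductorNorm ℤ = N →
        ∃ D : ModularParametrizationData (freyCurve a b) N,
          (D.maninConstant.natAbs : ℝ) ≤ M * (N : ℝ) ^ B')
    (h : _root_.ABC) : PolyFreyDegree :=
  polyFreyDegree_of_bakerShapeBound_of_petersson_of_manin hUp hM (bakerShapeBound_zero_one_of_abc h)

/-- **The sandwich.** Relative to Murty's two true-in-print inputs, the item `PolyFreyDegree`
(stmt-ABC-2026) lies between the summit statement `ABC` and polynomial abc `BakerShapeBound 0 1`
(the second implication unconditional, (F1)): proving it proves polynomial abc, refuting it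
refutes abc — an open problem on both sides, expected true. [cite: MurtyCongruencePrimes1999, Thm. 1] -/
theorem polyFreyDegree_sandwich
    (hUp : ∃ B C₂ : ℝ, ∀ (N : ℕ) [NeZero N] (W : WeierstrassCurve ℚ) [W.IsElliptic]
      (f : CuspForm (Gamma0 N) 2), IsNewformOf W f →
        (peterssonProduct (Gamma0 N) 2 f f).re ≤ C₂ * (N : ℝ) ^ B)
    (hM : ∃ B' M : ℝ, ∀ a b : ℤ, IsCoprime a b → a * b * (a + b) ≠ 0 →
      ∀ (N : ℕ) [NeZero N], (freyCurve a b).conductorNorm ℤ = N →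
        ∃ D : ModularParametrizationData (freyCurve a b) N,
          (D.maninConstant.natAbs : ℝ) ≤ M * (N : ℝ) ^ B') :
    (_root_.ABC → PolyFreyDegree) ∧ (PolyFreyDegree → BakerShapeBound 0 1) :=
  ⟨polyFreyDegree_of_abc_of_petersson_of_manin hUp hM, bakerShapeBound_zero_one_of_polyFreyDegree⟩

end Summit.ABC.ABC.Theorems.DefiniteXiPolyFreyDegree

end
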